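import Summits.MatrixMultiplication.MatrixMultiplication.Theorems.LieRankDesigns.Negative.Basics

/-!
# Negative lemmas for the crux `LieRankDesigns` (stmt-MatrixMultiplication-7614), part C: the `θ∘det` twist and the pigeonhole bound

Refuter-side (cdisprove) support; no theorem asserts a Theses statement positively.  `p` odd throughout.

* `detChar_mul`, `detChar_ne_zero` (`θ∘det`, `θ` the quadratic character, inlined), `exists_fixing_unit`, `sum_psi_mul_detChar_eq_zero`: twisted Gauss sums
  `Σ_{g ∈ GL_m(𝔽_p)} ψ(tr Mg) θ(det g)` vanish for `rk M < m` (rank-one correction along a kernel vector);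
* `sum_fourierFn_mul_detChar_eq_zero`, `delta_not_mem_levelSet`: level-`k < m` functions are
  `⊥ θ∘det`, so no delta function has level `< m`;
* `card_image_XY`, `card_image_YZ` (the TPP shadow of separation), `exists_mul_eq_of_card_lt`;
* `card_XY_add_card_YZ_le`: PIGEONHOLE `|X||Y| + |Y||Z| ≤ |GL_m(𝔽_p)|` (`k < m`, `X, Z ≠ ∅`).
-/

noncomputable section

open scoped BigOperators
open Literature.RepresentationTheory.FiniteGroups

namespace Summit.MatrixMultiplication.MatrixMultiplication.Theorems.LieRankDesigns.Negative

open Summit.MatrixMultiplication.MatrixMultiplication.Theses.LevelGradedCohnUmans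

variable {p m : ℕ}

/-! ## Orthogonality to `θ∘det` below the top level, and the PIGEONHOLE bound `|X||Y| + |Y||Z| ≤ |G|` -/

section Pigeonhole

variable [Fact p.Prime]

/-- `θ∘det` is multiplicative. [folklore] -/
theorem detChar_mul (g h : GLm p m) : ((quadraticChar (ZMod p) (((g * h) : GLm p m) : Mat p m).det : ℤ) : ℂ) = ((quadraticChar (ZMod p) ((g : GLm p m) : Mat p m).det : ℤ) : ℂ) * ((quadraticChar (ZMod p) ((h : GLm p m) : Mat p m).det : ℤ) : ℂ) := by
  rw [Units.val_mul, Matrix.det_mul, map_mul, Int.cast_mul]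

/-- `θ∘det` does not vanish on `GL_m`. [folklore] -/
theorem detChar_ne_zero (g : GLm p m) : ((quadraticChar (ZMod p) ((g : GLm p m) : Mat p m).det : ℤ) : ℂ) ≠ 0 := by
  have hdet : (g : Mat p m).det ≠ 0 := by
    rw [← Matrix.GeneralLinearGroup.val_det_apply]; exact Units.ne_zero _
  rcases quadraticChar_dichotomy hdet with h | h <;> rw [h] <;> norm_num

/-- A matrix of rank `< m` is fixed under right multiplication by some `H ∈ GL_m` of any prescribed
nonzero determinant `a`: `M H = M`, `det H = a` (rank-one correction along a kernel vector). -/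
theorem exists_fixing_unit {M : Mat p m} (hM : M.rank < m) {a : ZMod p} (ha : a ≠ 0) :
    ∃ h : GLm p m, M * (h : Mat p m) = M ∧ (h : Mat p m).det = a := by
  classical
  -- a nonzero kernel vector
  have hker : LinearMap.ker M.mulVecLin ≠ ⊥ := by
    intro hbot
    have h := LinearMap.finrank_range_add_finrank_ker M.mulVecLin
    rw [hbot, finrank_bot, add_zero, Module.finrank_fintype_fun_eq_card, Fintype.card_fin] at h
    unfold Matrix.rank at hM
    omega
  obtain ⟨u, hu, hu0⟩ := Submodule.exists_mem_ne_zero_of_ne_bot hker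
  rw [LinearMap.mem_ker, Matrix.mulVecLin_apply] at hu
  obtain ⟨i, hi⟩ := Function.ne_iff.mp hu0
  set v : Fin m → ZMod p := Pi.single i (u i)⁻¹ with hv
  have hvu : v ⬝ᵥ u = 1 := by
    rw [hv, single_dotProduct, inv_mul_cancel₀ hi]
  set H : Mat p m := 1 + Matrix.vecMulVec ((a - 1) • u) v with hH
  have hMH : M * H = M := by
    rw [hH, Matrix.mul_add, Matrix.mul_one, Matrix.mul_vecMulVec, Matrix.mulVec_smul, hu, smul_zero]
    ext i j
    simp
  have hdet : H.det = a := by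
    rw [hH, Matrix.vecMulVec_eq Unit, Matrix.det_one_add_replicateCol_mul_replicateRow, dotProduct_smul,
      hvu, smul_eq_mul, mul_one]
    ring
  refine ⟨Matrix.GeneralLinearGroup.mkOfDetNeZero H (by rw [hdet]; exact ha), ?_, ?_⟩
  · exact hMH
  · exact hdet

/-- **Twisted Gauss sums over `GL_m` vanish below full rank** (`p` odd): for `rk M < m`,
`Σ_{g ∈ GL_m(𝔽_p)} ψ(tr(M g)) · θ(det g) = 0`, `θ` the quadratic character. -/
theorem sum_psi_mul_detChar_eq_zero (hp : p ≠ 2) {M : Mat p m} (hM : M.rank < m) :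
    ∑ g : GLm p m, ZMod.stdAddChar (Matrix.trace (M * (g : Mat p m))) * ((quadraticChar (ZMod p) ((g : GLm p m) : Mat p m).det : ℤ) : ℂ) = 0 := by
  classical
  have hch : ringChar (ZMod p) ≠ 2 := by rw [ZMod.ringChar_zmod_n]; exact hp
  obtain ⟨a, ha⟩ := quadraticChar_exists_neg_one hch
  have ha0 : a ≠ 0 := by rintro rfl; rw [quadraticChar_zero] at ha; norm_num at ha
  obtain ⟨h, hMh, hdet⟩ := exists_fixing_unit hM ha0
  have hθh : ((quadraticChar (ZMod p) ((h : GLm p m) : Mat p m).det : ℤ) : ℂ) = -1 := by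
    rw [hdet, ha]; norm_num
  set F : GLm p m → ℂ := fun g => ZMod.stdAddChar (Matrix.trace (M * (g : Mat p m))) * ((quadraticChar (ZMod p) ((g : GLm p m) : Mat p m).det : ℤ) : ℂ)
  have hF : ∀ g, F (h * g) = -F g := by
    intro g
    simp only [F]
    rw [Units.val_mul, ← Matrix.mul_assoc, hMh, Matrix.det_mul, map_mul, Int.cast_mul, hθh]
    ring
  have hsum : ∑ g, F g = ∑ g, F (h * g) := (Equiv.sum_comp (Equiv.mulLeft h) F).symm
  simp only [hF, Finset.sum_neg_distrib] at hsum
  have h2 : ∑ g, F g + ∑ g, F g = 0 := by nth_rewrite 2 [hsum]; ring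
  exact add_self_eq_zero.mp h2

/-- **Every level-`k` function, `k < m`, is orthogonal to `θ∘det`** (`p` odd). -/
theorem sum_fourierFn_mul_detChar_eq_zero (hp : p ≠ 2) {k : ℕ} (hkm : k < m) {c : Mat p m → ℂ}
    (hc : RankSupp k c) : ∑ g : GLm p m, fourierFn c g * ((quadraticChar (ZMod p) ((g : GLm p m) : Mat p m).det : ℤ) : ℂ) = 0 := by
  unfold fourierFn
  simp_rw [Finset.sum_mul]
  rw [Finset.sum_comm]
  refine Finset.sum_eq_zero fun M _ => ?_
  by_cases hMk : k < M.rank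
  · simp [hc M hMk]
  · simp_rw [mul_assoc]
    rw [← Finset.mul_sum, sum_psi_mul_detChar_eq_zero hp (by omega), mul_zero]

/-- In particular a delta function is never of level `k < m` (`p` odd). -/
theorem delta_not_mem_levelSet (hp : p ≠ 2) {k : ℕ} (hkm : k < m) (g₀ : GLm p m) :
    (fun g => if g = g₀ then (1 : ℂ) else 0) ∉ levelSet p m k := by
  classical
  rintro ⟨c, hc, hfc⟩
  have h := sum_fourierFn_mul_detChar_eq_zero hp hkm hc
  have : ∑ g : GLm p m, fourierFn c g * ((quadraticChar (ZMod p) ((g : GLm p m) : Mat p m).det : ℤ) : ℂ) = ((quadraticChar (ZMod p) ((g₀ : GLm p m) : Mat p m).det : ℤ) : ℂ) := by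
    simp_rw [← hfc]
    simp [Finset.sum_ite_eq']
  rw [this] at h
  exact detChar_ne_zero g₀ h

variable {k : ℕ} {X Y Z : Finset (GLm p m)}

/-- Separation makes `(x, y) ↦ x⁻¹ y` injective on `X × Y` (given some `z₀ ∈ Z`). -/
theorem card_image_XY (hsep : RankSep k X Y Z) (hZ : Z.Nonempty) :
    ((X ×ˢ Y).image fun t => t.1⁻¹ * t.2).card = X.card * Y.card := by
  classical
  obtain ⟨z₀, hz₀⟩ := hZ
  rw [← Finset.card_product]
  refine Finset.card_image_of_injOn ?_
  rintro ⟨x₁, y₁⟩ h₁ ⟨x₂, y₂⟩ h₂ heq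
  simp only [Finset.coe_product, Set.mem_prod, Finset.mem_coe] at h₁ h₂
  simp only at heq
  obtain ⟨c, -, hsepc⟩ := hsep x₁ h₁.1 z₀ hz₀
  have ht := hsepc x₁ h₁.1 y₁ h₁.2 y₁ h₁.2 z₀ hz₀
  rw [if_pos ⟨rfl, rfl, rfl⟩] at ht
  have h' := hsepc x₂ h₂.1 y₂ h₂.2 y₁ h₁.2 z₀ hz₀
  rw [show x₂⁻¹ * y₂ * y₁⁻¹ * z₀ = x₁⁻¹ * y₁ * y₁⁻¹ * z₀ by rw [heq], ht] at h'
  by_contra hne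
  rw [if_neg] at h'
  · exact one_ne_zero h'
  · rintro ⟨rfl, rfl, -⟩; exact hne rfl

/-- Separation makes `(y', z) ↦ y'⁻¹ z` injective on `Y × Z` (given some `x₀ ∈ X`). -/
theorem card_image_YZ (hsep : RankSep k X Y Z) (hX : X.Nonempty) :
    ((Y ×ˢ Z).image fun t => t.1⁻¹ * t.2).card = Y.card * Z.card := by
  classical
  obtain ⟨x₀, hx₀⟩ := hX
  rw [← Finset.card_product]
  refine Finset.card_image_of_injOn ?_
  rintro ⟨y₁, z₁⟩ h₁ ⟨y₂, z₂⟩ h₂ heq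
  simp only [Finset.coe_product, Set.mem_prod, Finset.mem_coe] at h₁ h₂
  simp only at heq
  obtain ⟨c, -, hsepc⟩ := hsep x₀ hx₀ z₁ h₁.2
  have ht := hsepc x₀ hx₀ y₁ h₁.1 y₁ h₁.1 z₁ h₁.2
  rw [if_pos ⟨rfl, rfl, rfl⟩] at ht
  have h' := hsepc x₀ hx₀ y₁ h₁.1 y₂ h₂.1 z₂ h₂.2
  rw [show x₀⁻¹ * y₁ * y₂⁻¹ * z₂ = x₀⁻¹ * y₁ * y₁⁻¹ * z₁ by
    rw [mul_assoc, ← heq, ← mul_assoc], ht] at h'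
  by_contra hne
  rw [if_neg] at h'
  · exact one_ne_zero h'
  · rintro ⟨-, rfl, rfl⟩; exact hne rfl

/-- Pigeonhole in a finite group: if `|A| + |B| > |G|` then `A · B = G`. -/
theorem exists_mul_eq_of_card_lt {G : Type} [Group G] [Fintype G] [DecidableEq G] (A B : Finset G)
    (h : Fintype.card G < A.card + B.card) (g : G) : ∃ a ∈ A, ∃ b ∈ B, a * b = g := by
  set A' := A.image fun a => a⁻¹ * g with hA'
  have hcard : A'.card = A.card := by
    refine Finset.card_image_of_injective _ fun a₁ a₂ h12 => ?_
    simpa using h12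
  have hnd : ¬ Disjoint A' B := by
    intro hd
    have := Finset.card_le_univ (A' ∪ B)
    rw [Finset.card_union_of_disjoint hd, hcard] at this
    omega
  obtain ⟨b, hb, hbA⟩ : ∃ b ∈ B, b ∈ A' := by
    simpa [Finset.not_disjoint_iff, and_comm] using hnd
  rw [hA', Finset.mem_image] at hbA
  obtain ⟨a, ha, rfl⟩ := hbA
  exact ⟨a, ha, _, hb, by group⟩

/-- **PIGEONHOLE BOUND.**  For `p` odd and `k < m`, an `F_k`-separated triple with `X, Z ≠ ∅`
satisfies `|X|·|Y| + |Y|·|Z| ≤ |GL_m(𝔽_p)|`: otherwise `X⁻¹Y · Y⁻¹Z = G`, the separating function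
of a target is then forced to be a delta function on all of `G`, and delta functions are not of
level `k < m` (`delta_not_mem_levelSet`).  (Kills e.g. the `(5,5,5)` pattern in `GL_2(𝔽_3)`.) -/
theorem card_XY_add_card_YZ_le (hp : p ≠ 2) (hkm : k < m) (hsep : RankSep k X Y Z)
    (hX : X.Nonempty) (hZ : Z.Nonempty) :
    X.card * Y.card + Y.card * Z.card ≤ Fintype.card (GLm p m) := by
  classical
  by_contra hlt
  push Not at hlt
  rw [← card_image_XY hsep hZ, ← card_image_YZ hsep hX] at hlt
  obtain ⟨x₀, hx₀⟩ := hX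
  obtain ⟨z₀, hz₀⟩ := hZ
  obtain ⟨c, hc, hsepc⟩ := hsep x₀ hx₀ z₀ hz₀
  apply delta_not_mem_levelSet hp hkm (x₀⁻¹ * z₀)
  refine ⟨c, hc, fun g => ?_⟩
  obtain ⟨a, ha, b, hb, hab⟩ := exists_mul_eq_of_card_lt _ _ hlt g
  rw [Finset.mem_image] at ha hb
  obtain ⟨⟨x, y⟩, hxy, rfl⟩ := ha
  obtain ⟨⟨y', z⟩, hyz, rfl⟩ := hb
  rw [Finset.mem_product] at hxy hyz
  simp only at hab hxy hyz
  have hval := hsepc x hxy.1 y hxy.2 y' hyz.1 z hyz.2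
  rw [show x⁻¹ * y * y'⁻¹ * z = g by rw [← hab]; group] at hval
  show (if g = x₀⁻¹ * z₀ then (1 : ℂ) else 0) = fourierFn c g
  rw [hval]
  by_cases hg : g = x₀⁻¹ * z₀
  · rw [if_pos hg]
    -- the value at the target is 1, computed from the target quadruple (x₀, y, y, z₀)
    have h1 := hsepc x₀ hx₀ y hxy.2 y hxy.2 z₀ hz₀
    rw [if_pos ⟨rfl, rfl, rfl⟩, show x₀⁻¹ * y * y⁻¹ * z₀ = g by rw [hg]; group] at h1
    rw [← hval, h1]
  · rw [if_neg hg, if_neg]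
    rintro ⟨rfl, rfl, rfl⟩
    exact hg (by rw [← hab]; group)

end Pigeonhole

end Summit.MatrixMultiplication.MatrixMultiplication.Theorems.LieRankDesigns.Negative

end
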